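import Summits.KontsevichZagierPeriods.Zeta5Search.LaiSweepShard

/-!
# `κ₃` sweep certificate — shard file 035 of 127 (shards 245–251 of 889)

HONEST FRAMING. Systematic search; no irrationality claim unless certified. This file only checks,
by `decide +kernel`, shards 245–251 of the order-cell sweep of the `κ₃` point `(74, 2180, 444; δ74)`
(engine `LaiSweepEngine`, soundness `LaiSweepJump/Free/Eval/Shard/Kappa3`; a shard is `⟨regime, n,
p, q, p', q', Lo, Up⟩`: `n` cells from `p/q` to `p'/q'` with integer rate sums in `[Lo, Up]`, `K =
128`, `D = 2^40`). It draws NO conclusion: only the capstone `LaiKappa3SweepCert`, which needs all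
127 shard files, does. Kernel cost of this file ≈ 560 cells × 0.3 s.
-/

namespace Summit.KontsevichZagierPeriods.Zeta5Search.Sweep

set_option maxHeartbeats 100000000 in
/-- Shard 245: 80 cells of regime B from `65/342` to `75/392`.
[cite: Lai2024BallRivoal, §4 Lemma 4.3] -/
theorem shard245 :
    Shard.check 128 (2^40)
      ⟨true, 80, 65, 342, 75, 392, 34523768518572, 35401063992422⟩ = true := by
  decide +kernel

set_option maxHeartbeats 100000000 in
/-- Shard 246: 80 cells of regime B from `75/392` to `57/296`.
[cite: Lai2024BallRivoal, §4 Lemma 4.3] -/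
theorem shard246 :
    Shard.check 128 (2^40)
      ⟨true, 80, 75, 392, 57, 296, 33630763506471, 34497221605393⟩ = true := by
  decide +kernel

set_option maxHeartbeats 100000000 in
/-- Shard 247: 80 cells of regime B from `57/296` to `44/227`.
[cite: Lai2024BallRivoal, §4 Lemma 4.3] -/
theorem shard247 :
    Shard.check 128 (2^40)
      ⟨true, 80, 57, 296, 44, 227, 34019002591173, 34908143774044⟩ = true := by
  decide +kernel

set_option maxHeartbeats 100000000 in
/-- Shard 248: 80 cells of regime B from `44/227` to `937/4804`.
[cite: Lai2024BallRivoal, §4 Lemma 4.3] -/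
theorem shard248 :
    Shard.check 128 (2^40)
      ⟨true, 80, 44, 227, 937, 4804, 32511432494531, 33373571963443⟩ = true := by
  decide +kernel

set_option maxHeartbeats 100000000 in
/-- Shard 249: 80 cells of regime B from `937/4804` to `32/163`.
[cite: Lai2024BallRivoal, §4 Lemma 4.3] -/
theorem shard249 :
    Shard.check 128 (2^40)
      ⟨true, 80, 937, 4804, 32, 163, 33858309867547, 34770006874428⟩ = true := by
  decide +kernel

set_option maxHeartbeats 100000000 in
/-- Shard 250: 80 cells of regime B from `32/163` to `49/248`.
[cite: Lai2024BallRivoal, §4 Lemma 4.3] -/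
theorem shard250 :
    Shard.check 128 (2^40)
      ⟨true, 80, 32, 163, 49, 248, 33370133435012, 34281695175357⟩ = true := by
  decide +kernel

set_option maxHeartbeats 100000000 in
/-- Shard 251: 80 cells of regime B from `49/248` to `33/166`.
[cite: Lai2024BallRivoal, §4 Lemma 4.3] -/
theorem shard251 :
    Shard.check 128 (2^40)
      ⟨true, 80, 49, 248, 33, 166, 31890527944444, 32773849554110⟩ = true := by
  decide +kernel

/-- The checked shards of this file, in order. [folklore] -/
def shards035 : List (CheckedShard 128 (2^40)) :=
  [⟨_, shard245⟩, ⟨_, shard246⟩, ⟨_, shard247⟩, ⟨_, shard248⟩, ⟨_, shard249⟩,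
    ⟨_, shard250⟩, ⟨_, shard251⟩]

end Summit.KontsevichZagierPeriods.Zeta5Search.Sweep
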